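import Summits.HubbardSuperconductivity.HubbardSuperconductivity.Theorems.AnisotropyChordTransferGapScale
import Summits.HubbardSuperconductivity.HubbardSuperconductivity.Theorems.AnisotropyChordTransferFeynmanBijl
import Summits.HubbardSuperconductivity.HubbardSuperconductivity.Theorems.AnisotropyChordTransferFsumBound
import Summits.HubbardSuperconductivity.HubbardSuperconductivity.Theorems.AnisotropyChordEnergyConvexHolds

/-!
# Theory seat `hubbard-h0-rotor-theory-1`, cycle 14 (g14) — Part N14 (v2): THE CONVEXITY-FED LINEAR TRANSFER CHAIN, PROVED
# (memo ROTOR-THEORY-14 §193, §197; port spec W = this file verbatim).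
(Verbatim port of the theory seat `hubbard-h0-rotor-theory-1` file `cycle14/lean/PartN14.lean (v2)`, sha16 c04a6387500447e8, by the prover seat
`hubbard-h0-rotor-p1` g18: tree namespace, linter option and docstring tags only; no new mathematics.)

The tree's transfer chain for route (1) «anchor + transfer» (`abstract_chain`, `firstLinksUpTo_of_gapScale`) controls the
chemical-potential part of the one-link Temple numerator by a RECURSION through the floor `ν|V|²` of `‖S⁺ψ_i‖²`, which produces
the geometric constants `cSeq/dSeq` (`D_k ~ (4/c₀)^k`, e.g. `C₀ ≥ 1.3·10⁴` in `condensateOnFirstSectors_repulsive_of_gapInvV`).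
The tree ALSO contains, unused by that chain, the kernel-checked theorem
`xxzSectorEnergyConvex_holds : XXZSectorEnergyConvex` (sector energies `M ↦ E(M)` of `H(Δ) = −Σ (SˣSˣ+SʸSʸ+ΔSᶻSᶻ)`, `|Δ| ≤ 1`,
are CONVEX on every finite graph; axioms `propext, Classical.choice, Quot.sound` — checked g14, `cycle14/AxCheck.lean`).

Feeding convexity into the one-link step gives LEMMA X below: the tower excess numerator
`X_M·N_M := ⟨S⁺ψ_M, H S⁺ψ_M⟩ − E(M+1)‖S⁺ψ_M‖²` is bounded by `4(1−Δ)L² + 8(1+|Δ|)M` — LINEAR in `M`, with NO reference to the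
condensate floor, hence a linear (non-recursive) chain (`linearLadder`, proved here):
  `⟨S⃗²⟩_{ψ_{M+1}} ≥ ⟨S⃗²⟩_{ψ_M} − (4(1−Δ)L² + 8(1+|Δ|)M) / g_{M+1}`.
LEMMA X is PROVED in this file (Part F, `towerExcess_linear`, tree-only energy window, constant `B = 32`), and so are the
consequences (Part G) — the ONLY remaining hypotheses are the anchor (a theorem on `−0.15 ≤ Δ ≤ 0`) and the symmetric-sector gap:
* `GapInvVLinear`: `4(1−Δ)k < c₀·C`, anchor `c₀`, `SymmetricSectorGapInvV Δ C (k+1)` ⇒ `CondensateOnFirstSectors Δ k`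
  (tree threshold `C₀ = 2(k+1)D_k/c₀ + 1`, `≈ 3.7·10³` at `k = 1, Δ = 0, c₀ = 0.19`; new threshold `21`; data `g_sym·|V| = 42…75`
  at `|V| = 16…25`, memo 12 §185);
* `LinearWindowTransfer`: anchor `c₀` + symmetric gap `c₁/L` on the GROWING window `|j| ≤ θ₀ L` ⇒ condensate density `≥ c₀/2` on
  every sector `0 ≤ j ≤ θ L`, `θ = min(θ₀, c₀c₁/(16(1−Δ)))` — the first statement of route (1) whose number of sectors diverges
  (fillings `|ρ − ½| ≤ θ/L`);
* METHOD CEILING of the gap currency: positive doping density `|ρ−½| = δ > 0` would need `Σ_{j ≤ δ|V|} 1/g_sym(j) ≤ c₀|V|/(8(1−Δ))`,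
  false for the physical `g_sym ≈ 13.6/L` (two phonons); beyond `θ/L` only the fidelity currency `TowerFidelityWindow` (tree,
  `1 − F_j ≤ C/|V|`) reaches.
Statements over tree declarations only; the residual hypothesis of route (1) (a symmetric-sector gap beating `1/|V|`) is UNCHANGED
and remains an open problem (memo 13 §191, memo 14 §195).
-/

set_option linter.dupNamespace false
set_option autoImplicit false

noncomputable section

open Finset Filter Topology
open Literature.MathematicalPhysics.QuantumLattice Literature.Probability.LatticeModels
open Summit.HubbardSuperconductivity.HubbardSuperconductivity.Theorems.AnisotropyChord
open Summit.HubbardSuperconductivity.HubbardSuperconductivity.Theorems.AnisotropyChord.InsertionEntropy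
open Summit.HubbardSuperconductivity.HubbardSuperconductivity.Theorems.AnisotropyChord.Transfer
open Summit.HubbardSuperconductivity.HubbardSuperconductivity.Theorems.AnisotropyChord.Tower

namespace Summit.HubbardSuperconductivity.HubbardSuperconductivity.Theorems.AnisotropyChord.Transfer

/-! ## Part A — the abstract linear ladder (PROVED; replaces `abstract_chain` and its `cSeq/dSeq` bookkeeping) -/

/-- **LINEAR LADDER (bookkeeping, proved).**  `f M = ⟨S⃗²⟩_{ψ_M}`, `X M = X_M·N_M ≥ 0` the tower-excess numerator of link
`M → M+1`, `g (M+1) ≥ γ > 0` the symmetric gap used at that link.  One-link Temple steps `f(M+1) ≥ f(M) − X M / g(M+1)` and the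
linear excess bound `X M ≤ A + B·M` (`A = 4(1−Δ)L²`, `B = 8(1+|Δ|)`, LEMMA X) give `f k ≥ f 0 − (A·k + B·k²)/γ`. [folklore] -/
theorem linearLadder (f X g : ℕ → ℝ) (A B γ : ℝ) (k : ℕ) (hγ : 0 < γ) (hB : 0 ≤ B)
    (hlink : ∀ M, M < k → f M - X M / g (M + 1) ≤ f (M + 1))
    (hX : ∀ M, M < k → X M ≤ A + B * M) (hX0 : ∀ M, M < k → 0 ≤ X M)
    (hg : ∀ M, M < k → γ ≤ g (M + 1)) :
    f 0 - (A * k + B * (k : ℝ) ^ 2) / γ ≤ f k := by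
  -- prove the bound for every `n ≤ k` by induction on `n`
  suffices h : ∀ n, n ≤ k → f 0 - (A * n + B * (n : ℝ) ^ 2) / γ ≤ f n from h k le_rfl
  intro n
  induction n with
  | zero => intro _; simp
  | succ n ih =>
    intro hn
    have hn' : n < k := Nat.lt_of_succ_le hn
    have h1 := ih hn'.le
    have h2 := hlink n hn'
    have h3 := hX n hn'
    have h4 := hX0 n hn'
    have h5 := hg n hn'
    have hgpos : 0 < g (n + 1) := lt_of_lt_of_le hγ h5
    -- `X n / g (n+1) ≤ (A + B n)/γ`
    have h6 : X n / g (n + 1) ≤ (A + B * n) / γ := by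
      calc X n / g (n + 1) ≤ X n / γ := by
            apply div_le_div_of_nonneg_left h4 hγ h5
        _ ≤ (A + B * n) / γ := by
            apply div_le_div_of_nonneg_right h3 hγ.le
    -- `(A n + B n²) + (A + B n) ≤ A (n+1) + B (n+1)²`
    have h7 : (A * n + B * (n : ℝ) ^ 2) / γ + (A + B * n) / γ
        ≤ (A * (((n + 1 : ℕ) : ℝ)) + B * (((n + 1 : ℕ) : ℝ)) ^ 2) / γ := by
      rw [← add_div]
      apply div_le_div_of_nonneg_right _ hγ.le
      push_cast
      nlinarith
    linarith

/-- **COROLLARY (bookkeeping, proved): the deficit in units of `|V|²`.**  With `f 0 ≥ c₀ V²` (anchor, `V = L²`), gap floor `γ`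
and `A = a·V`:  `f k ≥ (c₀ − a k/(γ V) − B k²/(γ V²))·V²`.  Reading: `γ = C/V` (the `1/|V|` gap) costs `a k / C` of the
condensate budget — the LINEAR threshold `C > a k / c₀ = 4(1−Δ)k/c₀`; `γ = c₁/L` on `k ≤ θ L` costs `a θ / c₁ + o(1)`. [folklore] -/
theorem linearLadder_deficit (f X g : ℕ → ℝ) (a B γ V c₀ : ℝ) (k : ℕ) (hγ : 0 < γ) (hB : 0 ≤ B) (hV : 0 < V)
    (h0 : c₀ * V ^ 2 ≤ f 0)
    (hlink : ∀ M, M < k → f M - X M / g (M + 1) ≤ f (M + 1))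
    (hX : ∀ M, M < k → X M ≤ a * V + B * M) (hX0 : ∀ M, M < k → 0 ≤ X M)
    (hg : ∀ M, M < k → γ ≤ g (M + 1)) :
    (c₀ - a * k / (γ * V) - B * (k : ℝ) ^ 2 / (γ * V ^ 2)) * V ^ 2 ≤ f k := by
  have h := linearLadder f X g (a * V) B γ k hγ hB hlink hX hX0 hg
  have hV2 : 0 < V ^ 2 := by positivity
  have e : (c₀ - a * k / (γ * V) - B * (k : ℝ) ^ 2 / (γ * V ^ 2)) * V ^ 2
      = c₀ * V ^ 2 - (a * V * k + B * (k : ℝ) ^ 2) / γ := by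
    field_simp
    ring
  rw [e]
  linarith

/-- **FLOOR LADDER (bookkeeping with the positivity floor, proved).**  The one-link step at `M` is available only while
`f M ≥ Φ` (this is what keeps `‖S⁺ψ_M‖² = f M − M² − M > 0`); if the total budget `A k + B k²` fits under `f 0 − Φ`, the linear
bound propagates to every `n ≤ k`. [folklore] -/
theorem floorLadder (f : ℕ → ℝ) (A B Φ : ℝ) (k : ℕ) (hA : 0 ≤ A) (hB : 0 ≤ B)
    (hlink : ∀ M, M < k → Φ ≤ f M → f M - (A + B * M) ≤ f (M + 1))
    (hbudget : Φ ≤ f 0 - (A * k + B * (k : ℝ) ^ 2)) :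
    ∀ n, n ≤ k → f 0 - (A * n + B * (n : ℝ) ^ 2) ≤ f n := by
  intro n
  induction n with
  | zero => intro _; simp
  | succ n ih =>
    intro hn
    have hn' : n < k := Nat.lt_of_succ_le hn
    have h1 := ih hn'.le
    have hnk : (n : ℝ) ≤ k := by exact_mod_cast hn'.le
    have hn0 : (0 : ℝ) ≤ n := Nat.cast_nonneg n
    have hk0 : (0 : ℝ) ≤ k := Nat.cast_nonneg k
    have hsq : (n : ℝ) ^ 2 ≤ (k : ℝ) ^ 2 := pow_le_pow_left₀ hn0 hnk 2
    have hmono : A * n + B * (n : ℝ) ^ 2 ≤ A * k + B * (k : ℝ) ^ 2 := by nlinarith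
    have hΦ : Φ ≤ f n := by linarith
    have h2 := hlink n hn' hΦ
    have h7 : (A * n + B * (n : ℝ) ^ 2) + (A + B * n) ≤ A * (((n + 1 : ℕ) : ℝ)) + B * (((n + 1 : ℕ) : ℝ)) ^ 2 := by
      push_cast; nlinarith
    linarith

/-! ## Part B — LEMMA X: the tower excess is LINEAR in the sector index (convexity-fed; port spec W1) -/

/-- **LEMMA X (TOWER EXCESS, LINEAR FORM).**  For the Perron amplitude `a = ψ_M` of the integer sector `M ≥ 0`, `4M ≤ L²`:
`⟨S⁺a, H S⁺a⟩ − E(M+1)·‖S⁺a‖² ≤ 4(1−Δ)L² + 8(1+|Δ|)M`.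
PROOF (5 lines, all inputs in the tree).  Write `N = ‖S⁺a‖²`, `Ñ = ‖S⁻a‖² = N + 2M` (`raiseNormSq_eq_totalSpinSq`,
`lowerNormSq_eq_totalSpinSq`), `ep = ⟨S⁺a,HS⁺a⟩ − E(M)N`, `em = ⟨S⁻a,HS⁻a⟩ − E(M)Ñ`, `μ₊ = E(M+1) − E(M)`, `μ₋ = E(M) − E(M−1)`.
(1) LEMMA E (`ladderExcessBound_holds`, `Δ ≤ 1`): `ep + em ≤ 4(1−Δ)L²`.  (2) variational floor in sector `M−1`
(`sectorE_mul_le_energyQ`, `S⁻a` supported there): `em ≥ −μ₋Ñ`.  (3) Hence the left side `= ep − μ₊N ≤ 4(1−Δ)L² + μ₋Ñ − μ₊N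
= 4(1−Δ)L² − (μ₊ − μ₋)N + 2Mμ₋ ≤ 4(1−Δ)L² + 2Mμ₋` by E-CONV (`xxzSectorEnergyConvex_holds` at `M`: `μ₊ ≥ μ₋`; for `M = 0` the last
term is absent and E-CONV is not even needed since `em = ep` by spin flip).  (4) `μ₋ ≤ 4(1+|Δ|)` for `1 ≤ M ≤ L²/4 + 1`: by E-CONV
(monotone increments) `μ₋·(T − M + 1) ≤ E(T) − E(M−1)` with `T = L²/2`; `E(T) ≤ ⟨σ_T, Hσ_T⟩ ≤ |Δ|L²/2` for any configuration `σ_T` of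
that sector (variational principle) and `E(M−1) ≥ −‖H‖ ≥ −(1 + |Δ|/2)L²` (`2L²` bonds, `‖h_b‖ = ½ + |Δ|/4`), so
`μ₋ ≤ (1+|Δ|)L²/(L²/4) = 4(1+|Δ|)`.  ∎   (Odd `L`: integer sectors are empty, the statement is vacuous.)
PROVED for `B = 32` in Part F (`towerExcess_linear`). [folklore] -/
def TowerExcessLinear (Δ B : ℝ) : Prop :=
  ∀ (L : ℕ) [NeZero L] (M : ℕ), 4 * M ≤ L ^ 2 →
    ∀ a : TensorIndex (TorusSite 2 L) 2 → ℝ, IsPerronSectorGroundAmplitude L Δ (M : ℝ) a →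
      energyQ L Δ (raiseSum a) - sectorE L Δ ((M : ℝ) + 1) * raiseNormSq a
        ≤ 4 * (1 - Δ) * (L : ℝ) ^ 2 + B * (M : ℝ)

/-- LEMMA X holds on the whole E-CONV range `|Δ| ≤ 1`: PROVED below (Part F, `towerExcessLinearHolds`) with the tree-only energy
window (`perron_energy_bond_sum`, `brkMass ≤ 1`, `hopCorr ≤ 1`, `adjCount ≤ 4L²`), constant `B = 32`; the paper constant is
`8(1+|Δ|)` (norm bound `‖h_b‖ = ½ + |Δ|/4`).  The consequences below hold for every `B ≥ 0`.
[conjecture: theory seat hubbard-h0-rotor-theory-1, cycle 14, memo §197 — typed statement; PROVED in `AnisotropyChordTransferLinearLemmaX` (`towerExcessLinearHolds`)] -/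
def TowerExcessLinearHolds : Prop :=
  ∀ Δ : ℝ, -1 ≤ Δ → Δ ≤ 1 → TowerExcessLinear Δ 32

/-- The tower excess numerator is non-negative (variational principle in sector `M+1`; `sectorE_mul_le_energyQ`). [folklore] -/
def TowerExcessNonneg (Δ : ℝ) : Prop :=
  ∀ (L : ℕ) [NeZero L] (M : ℕ) (a : TensorIndex (TorusSite 2 L) 2 → ℝ), IsPerronSectorGroundAmplitude L Δ (M : ℝ) a →
    0 ≤ energyQ L Δ (raiseSum a) - sectorE L Δ ((M : ℝ) + 1) * raiseNormSq a

/-! ## Part C — consequences (port spec W3/W4; proofs: `linearLadder_deficit` + `totalSpinSq_succ_ge_of_gap` with `c₁ := g·L`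
+ LEMMA X + `exists_perron_nat` + `perronTranslationInvariant_holds` + `firstLinksGiveCondensate_holds`) -/

/-- **T-LIN at the `1/|V|` scale (linear threshold).**  `4(1−Δ)k < c₀ C`, anchor `c₀`, symmetric gap `≥ C/|V|` on `|j| ≤ k+1`
⇒ condensation on the first `k` sectors.  (Tree: `condensateOnFirstSectors_of_gapInvV_open` needs `C ≥ 2(k+1)D_k/c₀ + 1`,
`D_k` geometric in `k`.)  Chain: `ε = 4(1−Δ)k/C + 8(1+|Δ|)k²/(C L²) < c₀` eventually; `firstLinksGiveCondensate_holds`.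
[conjecture: theory seat hubbard-h0-rotor-theory-1, cycle 14, memo §193 — typed statement; PROVED in `AnisotropyChordTransferLinearHolds` (`gapInvVLinear_holds`)] -/
def GapInvVLinear : Prop :=
  ∀ (Δ c₀ C : ℝ) (k : ℕ), -1 < Δ → Δ < 1 → 0 < c₀ → 0 < C → 4 * (1 - Δ) * k < c₀ * C →
    HalfFillingAnchor Δ c₀ → SymmetricSectorGapInvV Δ C (k + 1) → CondensateOnFirstSectors Δ k

/-- **HYPOTHESIS (H2-window): symmetric sector gap `c₁/L` on the GROWING window `|j| ≤ θ₀ L`.**  Same Temple form as the tree's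
`SymmetricSectorGap Δ c₁ k`, with the fixed `k` replaced by `θ₀ L`.  LSW/ED: `g_sym ≈ 4π√(1−Δ)/L` at every fixed filling near `½`
(two phonons; memo 13 §188), so (H2-window) is the natural finite-size statement; it is of the same (open, Bogoliubov) class as (H2).
[conjecture: theory seat hubbard-h0-rotor-theory-1, cycle 14, memo §193 — OPEN hypothesis] -/
def SymmetricSectorGapLinearWindow (Δ c₁ θ₀ : ℝ) : Prop :=
  ∀ᶠ L : ℕ in atTop, ∀ [NeZero L], ∀ j : ℤ, (|j| : ℝ) ≤ θ₀ * L →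
    ∀ a φ : TensorIndex (TorusSite 2 L) 2 → ℝ,
      IsPerronSectorGroundAmplitude L Δ (j : ℝ) a →
      cplx L φ ∈ spinZSector (Λ := TorusSite 2 L) 1 (j : ℝ) →
      (∀ v σ, φ (shiftCfg L v σ) = φ σ) → ∑ σ, φ σ ^ 2 = 1 →
        c₁ / (L : ℝ) * (1 - (∑ σ, a σ * φ σ) ^ 2) ≤ energyQ L Δ φ - sectorE L Δ (j : ℝ)

/-- Conclusion shape: condensate density `≥ c` on every integer sector `0 ≤ j ≤ θ L` (fillings `½ ≤ ρ ≤ ½ + θ/L`; below half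
filling by spin flip), eventually in `L`.  Compare the tree's `CondensateOnWindow Δ δ c` (window `δ|V|`, positive doping density).
[conjecture: theory seat hubbard-h0-rotor-theory-1, cycle 14 — target-side statement] -/
def CondensateOnLinearWindow (Δ θ c : ℝ) : Prop :=
  ∀ᶠ L : ℕ in atTop, ∀ [NeZero L], ∀ j : ℕ, (j : ℝ) ≤ θ * L →
    ∀ a : TensorIndex (TorusSite 2 L) 2 → ℝ, IsPerronSectorGroundAmplitude L Δ (j : ℝ) a → c ≤ condensateDensity a

/-- **THEOREM T-LIN-W (growing window; port spec W4).**  Anchor `c₀` + (H2-window) `(c₁, θ₀)` ⇒ condensate density `≥ c₀/2` on all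
sectors `0 ≤ j ≤ θ L`, `θ = min(θ₀, c₀c₁/(16(1−Δ)))`.  Chain: per link the loss of `⟨S⃗²⟩` is `≤ (L/c₁)(4(1−Δ)L² + 8(1+|Δ|)M)`
(one-link Temple step `totalSpinSq_succ_ge_of_gap` + LEMMA X); summed over `M < j ≤ θL`: `≤ (4(1−Δ)θ/c₁ + 4(1+|Δ|)θ²/(c₁L))·L⁴
≤ (c₀/4 + o(1))L⁴`; `condensateDensity ψ_j = (f(j) − j² + j)/L⁴ ≥ c₀ − c₀/4 − o(1)`; positivity of `‖S⁺ψ_M‖² = f(M) − M² − M ≥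
(3c₀/4 − o(1))L⁴` along the chain and `4M ≤ L²` are eventually automatic.  This is the first statement of route (1) whose number
of condensed sectors DIVERGES with `L`; the gap currency cannot go further (memo 14 §193(e): positive doping density would need
`Σ_{j ≤ δ|V|} 1/g_sym(j) ≤ c₀|V|/(8(1−Δ))`).
[conjecture: theory seat hubbard-h0-rotor-theory-1, cycle 14, memo §193 — typed statement; PROVED in `AnisotropyChordTransferLinearHolds` (`linearWindowTransfer_holds`)] -/
def LinearWindowTransfer : Prop :=
  ∀ Δ c₀ c₁ θ₀ : ℝ, -1 < Δ → Δ < 1 → 0 < c₀ → 0 < c₁ → 0 < θ₀ →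
    HalfFillingAnchor Δ c₀ → SymmetricSectorGapLinearWindow Δ c₁ θ₀ →
      CondensateOnLinearWindow Δ (min θ₀ (c₀ * c₁ / (16 * (1 - Δ)))) (c₀ / 2)

/-- Anchor-free form on the repulsive window (anchor from `halfFillingAnchor_of_repulsive`, `c₀` existential there).
[conjecture: theory seat hubbard-h0-rotor-theory-1, cycle 14, memo §193 — typed statement; PROVED in `AnisotropyChordTransferLinearHolds` (`linearWindowTransferRepulsive_holds`)] -/
def LinearWindowTransferRepulsive : Prop :=
  ∀ Δ c₁ θ₀ : ℝ, -0.15 ≤ Δ → Δ ≤ 0 → 0 < c₁ → 0 < θ₀ →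
    SymmetricSectorGapLinearWindow Δ c₁ θ₀ → ∃ θ > (0 : ℝ), ∃ c > (0 : ℝ), CondensateOnLinearWindow Δ θ c

/-! ## Part D — sanity links to the tree (PROVED): the window hypothesis contains the fixed-`k` hypothesis -/

/-- (H2-window) ⇒ (H2) on the first `k` sectors, for every `k`. [folklore] -/
theorem symmetricSectorGap_of_linearWindow {Δ c₁ θ₀ : ℝ} (hθ : 0 < θ₀) (h : SymmetricSectorGapLinearWindow Δ c₁ θ₀) (k : ℕ) :
    SymmetricSectorGap Δ c₁ k := by
  have hk : ∀ᶠ L : ℕ in atTop, (k : ℝ) ≤ θ₀ * L := by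
    have ht : Tendsto (fun L : ℕ => θ₀ * (L : ℝ)) atTop atTop :=
      Tendsto.const_mul_atTop hθ tendsto_natCast_atTop_atTop
    exact ht.eventually_ge_atTop (k : ℝ)
  filter_upwards [h, hk] with L hL hkL
  intro _ j hj a φ ha hφ hinv hunit
  have hj' : (|j| : ℝ) ≤ θ₀ * L := by
    have : ((|j| : ℤ) : ℝ) ≤ (k : ℝ) := by exact_mod_cast hj
    push_cast at this
    linarith
  exact hL j hj' a φ ha hφ hinv hunit

/-- A linear window of condensed sectors contains every fixed initial segment. [folklore] -/
theorem condensateOnFirstSectors_of_linearWindow {Δ θ c : ℝ} (hθ : 0 < θ) (hc : 0 < c)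
    (h : CondensateOnLinearWindow Δ θ c) (k : ℕ) : CondensateOnFirstSectors Δ k := by
  intro j hj
  refine ⟨c, hc, ?_⟩
  have hk : ∀ᶠ L : ℕ in atTop, (k : ℝ) ≤ θ * L := by
    have ht : Tendsto (fun L : ℕ => θ * (L : ℝ)) atTop atTop :=
      Tendsto.const_mul_atTop hθ tendsto_natCast_atTop_atTop
    exact ht.eventually_ge_atTop (k : ℝ)
  filter_upwards [h, hk] with L hL hkL
  intro _ a ha
  have hjL : (j : ℝ) ≤ θ * L := le_trans (by exact_mod_cast hj) hkL
  exact hL j hjL a ha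

/-! ## Part E — THEOREM T-LIN-W PROVED modulo LEMMA X (the port reduces to W1) -/

set_option maxHeartbeats 800000 in
/-- **THEOREM T-LIN-W (growing window), conditional on LEMMA X.**  For `Δ < 1`, any `B ≥ 0` with `TowerExcessLinear Δ B`:
anchor `c₀` + (H2-window) `(c₁, θ₀)` ⇒ condensate density `≥ c₀/2` on every integer sector `0 ≤ j ≤ θL`,
`θ = min(θ₀, c₀c₁/(16(1−Δ)))`.  Inputs from the tree: `totalSpinSq_succ_ge_of_gap` (one-link Temple step),
`perronTranslationInvariant_holds`, `exists_perron_nat`, `exists_perron_zero_of_even`, `even_of_perron_nat`, `perron_eq`,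
`raiseNormSq_eq_totalSpinSq`, `lowerNormSq_eq_totalSpinSq`; bookkeeping `floorLadder`.
[conjecture: theory seat hubbard-h0-rotor-theory-1, cycle 14, memo §193 — Lean proof here, modulo W1] -/
theorem condensateOnLinearWindow_of_gapLinearWindow {Δ c₀ c₁ θ₀ B : ℝ} (hΔ1 : Δ < 1) (hc₀ : 0 < c₀)
    (hc₁ : 0 < c₁) (hθ₀ : 0 < θ₀) (hB : 0 ≤ B) (hX : TowerExcessLinear Δ B)
    (hA : HalfFillingAnchor Δ c₀) (hGap : SymmetricSectorGapLinearWindow Δ c₁ θ₀) :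
    CondensateOnLinearWindow Δ (min θ₀ (c₀ * c₁ / (16 * (1 - Δ)))) (c₀ / 2) := by
  have hInv : PerronTranslationInvariant Δ := perronTranslationInvariant_holds Δ
  obtain ⟨η, hηdef⟩ : ∃ η : ℝ, η = 1 - Δ := ⟨_, rfl⟩
  have hη : 0 < η := by rw [hηdef]; linarith
  have h16 : 0 < 16 * (1 - Δ) := by linarith
  obtain ⟨θ, hθdef⟩ : ∃ θ : ℝ, θ = min θ₀ (c₀ * c₁ / (16 * (1 - Δ))) := ⟨_, rfl⟩
  have hθθ₀ : θ ≤ θ₀ := by rw [hθdef]; exact min_le_left _ _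
  have hθ2 : θ ≤ c₀ * c₁ / (16 * η) := by rw [hθdef, hηdef]; exact min_le_right _ _
  have hθ : 0 < θ := by
    rw [hθdef]; exact lt_min hθ₀ (div_pos (mul_pos hc₀ hc₁) h16)
  -- the budget inequality `4ηθ/c₁ ≤ c₀/4`
  have hbud : 4 * η * θ / c₁ ≤ c₀ / 4 := by
    have h1 : θ * (16 * η) ≤ c₀ * c₁ := (le_div_iff₀ (by positivity)).mp hθ2
    rw [div_le_iff₀ hc₁]; nlinarith
  -- the lower-order constant
  obtain ⟨K, hKdef⟩ : ∃ K : ℝ, K = B * θ ^ 2 / c₁ + 2 * θ ^ 2 + θ + 1 := ⟨_, rfl⟩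
  -- largeness of `L`
  have hT1 : ∀ᶠ L : ℕ in atTop, K ≤ c₀ / 4 * (L : ℝ) := by
    have ht : Tendsto (fun L : ℕ => c₀ / 4 * (L : ℝ)) atTop atTop :=
      Tendsto.const_mul_atTop (by positivity) tendsto_natCast_atTop_atTop
    exact ht.eventually_ge_atTop K
  have hT2 : ∀ᶠ L : ℕ in atTop, 4 * θ ≤ (L : ℝ) := tendsto_natCast_atTop_atTop.eventually_ge_atTop _
  have hT3 : ∀ᶠ L : ℕ in atTop, (1 : ℝ) ≤ (L : ℝ) := tendsto_natCast_atTop_atTop.eventually_ge_atTop _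
  rw [← hθdef]
  filter_upwards [hA, hGap, hT1, hT2, hT3] with L hAL hGapL hT1L hT2L hT3L
  intro _ j hj a ha
  -- parity and the sector-0 amplitude
  have hev : Even L := even_of_perron_nat ha
  obtain ⟨a₀, ha₀⟩ := exists_perron_zero_of_even Δ hev
  -- sizes
  have hLpos : (0 : ℝ) < L := by linarith
  have hW : (Fintype.card (TorusSite 2 L) : ℝ) = (L : ℝ) ^ 2 := by
    rw [Fintype.card_fun, ZMod.card, Fintype.card_fin]; push_cast; ring
  have hj0 : (0 : ℝ) ≤ j := Nat.cast_nonneg _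
  have hθL : θ * L ≤ θ₀ * L := mul_le_mul_of_nonneg_right hθθ₀ hLpos.le
  have hjr : (2 : ℝ) * j ≤ (L : ℝ) ^ 2 := by nlinarith
  have hj2 : 2 * j ≤ L ^ 2 := by exact_mod_cast hjr
  -- Perron amplitudes of the sectors `0 … j`
  have hexN : ∀ i : ℕ, i ≤ j → ∃ b : TensorIndex (TorusSite 2 L) 2 → ℝ,
      IsPerronSectorGroundAmplitude L Δ (i : ℝ) b := fun i hi => exists_perron_nat ha₀ i (by omega)
  choose! ψ hψ using hexN
  have hψ0 : IsPerronSectorGroundAmplitude L Δ 0 (ψ 0) := by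
    have := hψ 0 (Nat.zero_le _); rwa [Nat.cast_zero] at this
  have ea : a = ψ j := perron_eq ha (hψ j le_rfl)
  rw [ea]
  -- the sequence `f i = ⟨S⃗²⟩_{ψ_i}`
  obtain ⟨f, hf⟩ : ∃ f : ℕ → ℝ, ∀ i, f i =
      Summit.HubbardSuperconductivity.HubbardSuperconductivity.Theorems.AnisotropyChord.Tower.totalSpinSq (ψ i) (i : ℝ) :=
    ⟨_, fun _ => rfl⟩
  -- anchor: `c₀ L⁴ ≤ f 0`
  have hf0 : c₀ * ((L : ℝ) ^ 2) ^ 2 ≤ f 0 := by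
    have h := hAL (ψ 0) hψ0
    have e0 : condensateDensity (ψ 0) = lowerNormSq (ψ 0) / (Fintype.card (TorusSite 2 L) : ℝ) ^ 2 := rfl
    rw [e0, hW, le_div_iff₀ (by positivity)] at h
    have : f 0 = lowerNormSq (ψ 0) := by
      rw [hf]
      unfold Summit.HubbardSuperconductivity.HubbardSuperconductivity.Theorems.AnisotropyChord.Tower.totalSpinSq
      push_cast; ring
    rw [this]; exact h
  -- the positivity floor
  obtain ⟨Φ, hΦdef⟩ : ∃ Φ : ℝ, Φ = θ ^ 2 * (L : ℝ) ^ 2 + θ * L + 1 := ⟨_, rfl⟩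
  -- per-link constants
  obtain ⟨Aℓ, hAℓ⟩ : ∃ A : ℝ, A = (L : ℝ) / c₁ * (4 * η * (L : ℝ) ^ 2) := ⟨_, rfl⟩
  obtain ⟨Bℓ, hBℓ⟩ : ∃ B' : ℝ, B' = (L : ℝ) / c₁ * B := ⟨_, rfl⟩
  have hLc : 0 ≤ (L : ℝ) / c₁ := div_nonneg hLpos.le hc₁.le
  have hAℓ0 : 0 ≤ Aℓ := by rw [hAℓ]; positivity
  have hBℓ0 : 0 ≤ Bℓ := by rw [hBℓ]; exact mul_nonneg hLc hB
  -- THE LINK (one-link Temple step + LEMMA X), available while `Φ ≤ f M`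
  have hlink : ∀ M, M < j → Φ ≤ f M → f M - (Aℓ + Bℓ * M) ≤ f (M + 1) := by
    intro M hMj hΦM
    have hψM := hψ M hMj.le
    have hψM1 : IsPerronSectorGroundAmplitude L Δ ((M : ℝ) + 1) (ψ (M + 1)) := by
      have := hψ (M + 1) (by omega); push_cast at this; exact this
    have hM1r : (M : ℝ) + 1 ≤ j := by exact_mod_cast (by omega : M + 1 ≤ j)
    have hMr : (M : ℝ) ≤ θ * L := by linarith
    have hM0 : (0 : ℝ) ≤ M := Nat.cast_nonneg _
    have hMsq : (M : ℝ) ^ 2 ≤ θ ^ 2 * (L : ℝ) ^ 2 := by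
      rw [← mul_pow]; exact pow_le_pow_left₀ hM0 hMr 2
    -- `4M ≤ L²`
    have h4Mr : (4 : ℝ) * M ≤ (L : ℝ) ^ 2 := by nlinarith
    have h4M : 4 * M ≤ L ^ 2 := by exact_mod_cast h4Mr
    -- `‖S⁺ψ_M‖² > 0` from the floor
    have hN : 0 < raiseNormSq (ψ M) := by
      rw [raiseNormSq_eq_totalSpinSq hψM, ← hf]
      rw [hΦdef] at hΦM
      nlinarith
    -- the gap hypothesis at the sector `M+1` (inside the window `θ₀ L`)
    have hgap : ∀ φ : TensorIndex (TorusSite 2 L) 2 → ℝ,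
        cplx L φ ∈ spinZSector (Λ := TorusSite 2 L) 1 ((M : ℝ) + 1) → (∀ v σ, φ (shiftCfg L v σ) = φ σ) →
        ∑ σ, φ σ ^ 2 = 1 →
          c₁ / (L : ℝ) * (1 - (∑ σ, ψ (M + 1) σ * φ σ) ^ 2) ≤ energyQ L Δ φ - sectorE L Δ ((M : ℝ) + 1) := by
      intro φ hφ hφinv hφunit
      have ecast : (((M + 1 : ℕ) : ℤ) : ℝ) = (M : ℝ) + 1 := by push_cast; ring
      have habs : |((((M + 1 : ℕ) : ℤ) : ℝ))| ≤ θ₀ * L := by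
        rw [ecast, abs_of_nonneg (by positivity)]; linarith
      have h := hGapL ((M + 1 : ℕ) : ℤ) habs (ψ (M + 1)) φ
        (by rw [ecast]; exact hψM1) (by rw [ecast]; exact hφ) hφinv hφunit
      rw [ecast] at h; exact h
    have hone := totalSpinSq_succ_ge_of_gap hc₁ hψM hψM1 hgap (hInv L (M : ℝ) (ψ M) hψM) hN
    -- LEMMA X at the link `M`
    have hXM := hX L M h4M (ψ M) hψM
    rw [← hηdef] at hXM
    have h4 := mul_le_mul_of_nonneg_left hXM hLc
    have e : Aℓ + Bℓ * M = (L : ℝ) / c₁ * (4 * η * (L : ℝ) ^ 2 + B * (M : ℝ)) := by rw [hAℓ, hBℓ]; ring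
    rw [hf, hf, e]
    push_cast
    linarith
  -- budget: `Φ + Aℓ j + Bℓ j² ≤ c₀ L⁴ ≤ f 0`
  have hL2 : (L : ℝ) ^ 2 ≤ (L : ℝ) ^ 3 := by nlinarith
  have hL13 : (L : ℝ) ≤ (L : ℝ) ^ 3 := by nlinarith
  have hL03 : (1 : ℝ) ≤ (L : ℝ) ^ 3 := by nlinarith
  have hK3 : K * (L : ℝ) ^ 3 ≤ c₀ / 4 * (L : ℝ) ^ 4 := by
    have := mul_le_mul_of_nonneg_right hT1L (by positivity : (0 : ℝ) ≤ (L : ℝ) ^ 3)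
    nlinarith
  have hjsq : (j : ℝ) ^ 2 ≤ θ ^ 2 * (L : ℝ) ^ 2 := by
    rw [← mul_pow]; exact pow_le_pow_left₀ hj0 hj 2
  have hAj : Aℓ * j ≤ c₀ / 4 * (L : ℝ) ^ 4 := by
    calc Aℓ * j ≤ Aℓ * (θ * L) := mul_le_mul_of_nonneg_left hj hAℓ0
      _ = 4 * η * θ / c₁ * (L : ℝ) ^ 4 := by rw [hAℓ]; ring
      _ ≤ c₀ / 4 * (L : ℝ) ^ 4 := mul_le_mul_of_nonneg_right hbud (by positivity)
  have hBj : Bℓ * (j : ℝ) ^ 2 ≤ B * θ ^ 2 / c₁ * (L : ℝ) ^ 3 := by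
    calc Bℓ * (j : ℝ) ^ 2 ≤ Bℓ * (θ ^ 2 * (L : ℝ) ^ 2) := mul_le_mul_of_nonneg_left hjsq hBℓ0
      _ = B * θ ^ 2 / c₁ * (L : ℝ) ^ 3 := by rw [hBℓ]; ring
  have hlow : B * θ ^ 2 / c₁ * (L : ℝ) ^ 3 + 2 * (θ ^ 2 * (L : ℝ) ^ 2) + θ * L + 1 ≤ c₀ / 4 * (L : ℝ) ^ 4 := by
    have hθ2' : 0 ≤ θ ^ 2 := sq_nonneg _
    have e : K * (L : ℝ) ^ 3 = B * θ ^ 2 / c₁ * (L : ℝ) ^ 3 + 2 * θ ^ 2 * (L : ℝ) ^ 3 + θ * (L : ℝ) ^ 3 + (L : ℝ) ^ 3 := by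
      rw [hKdef]; ring
    have h1 := mul_le_mul_of_nonneg_left hL2 hθ2'
    have h2 := mul_le_mul_of_nonneg_left hL13 hθ.le
    nlinarith [hK3, e, h1, h2, hL03]
  have hL4 : ((L : ℝ) ^ 2) ^ 2 = (L : ℝ) ^ 4 := by ring
  rw [hL4] at hf0
  have hbudget : Φ ≤ f 0 - (Aℓ * j + Bℓ * (j : ℝ) ^ 2) := by
    rw [hΦdef]; nlinarith [hf0, hAj, hBj, hlow, sq_nonneg θ]
  -- run the ladder
  have hchain := floorLadder f Aℓ Bℓ Φ j hAℓ0 hBℓ0 hlink hbudget j le_rfl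
  -- read off the condensate density of `ψ_j`
  have e1 : condensateDensity (ψ j) = lowerNormSq (ψ j) / (Fintype.card (TorusSite 2 L) : ℝ) ^ 2 := rfl
  rw [e1, hW, hL4, le_div_iff₀ (by positivity), lowerNormSq_eq_totalSpinSq (j : ℝ) (ψ j), ← hf]
  nlinarith [hchain, hf0, hAj, hBj, hlow, hjsq, hj0, sq_nonneg θ]

end Summit.HubbardSuperconductivity.HubbardSuperconductivity.Theorems.AnisotropyChord.Transfer
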